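import Literature.AlgebraicGeometry.Milne1999.LefschetzGroupOneIsogeny
import Literature.AlgebraicGeometry.Milne1999.MumfordTateGroupPowersMulEquiv
import Literature.AlgebraicGeometry.Milne1999.LefschetzGroupProducts
import Literature.AlgebraicGeometry.Milne1999.LefschetzInvolutionIsLefschetz
import HarnessLib

/-!
# `S(A^{r+1})`, `G(A^{r+1})`, `{g₁ | g ∈ ker l(A^{r+1})}` and `L(A^{r+1})(ℂ)|_{H¹}` are `S(A)`, `G(A)`, `ker l(A)|_{H¹}`, `L(A)|_{H¹}`
# acting diagonally (Milne 1999, §1 p. 643 «as k-algebras with involution»; Prop. 1.5, Cor. 4.7)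

Milne [Milne1999LefschetzClasses, §1 p. 643]: «For any positive integer `r`, `V(Aʳ) = rV(A)`, and the diagonal action of
`C(A)` on `rV(A)` identifies `C(A)` with `C(Aʳ)`. … the involution [`D`] defines on `C(A)` is the restriction of the
product of the involutions on the `C(Aᵢ)` defined by the `Dᵢ` … (as `k`-algebras with involution)»; p. 644: `S(A) = {γ ∈ C(A) |
γ†γ = 1}`; Prop. 1.5 / Cor. 4.7 (`S`, `L` of a product); Thm. 4.4 (`ker l(A) = S(A)`, `L(A) ≅ G(A)`).

The tree has the diagonal embedding `u ↦ u^{⊕(a+1)}` (`diagPow`), `C(A) ≅ C(A^{a+1})`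
(`centralizerGroup.diagPowMulEquiv`), the bijective `S(A)(h) → S(A^{a+1})(Σ prᵢ^* h)` (`unitaryCentralizerGroup.diagPowHom`,
`exists_mem_unitaryCentralizerGroup_diagPow_eq` / `unitaryCentralizerGroup.diagPowHom_bijective` of
`Milne1999/LefschetzInvolutionIsLefschetz` §3) and the block form of the product polarization pairing
(`Milne1999/LefschetzGroupProducts`: `mem_similitudeCentralizerGroup_prod_iff`). This file (all `theorem`s, no definition,
no named fact) closes the circle for `G`, `ker l|_{H¹}`, `L|_{H¹}` and the Mumford–Tate group of the powers:
* §1 `Σ prᵢ^* h` is rational and of type `(1,1)` when `h` is;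
* §2 `S(A^{r+1})(Σ prᵢ^* h)(ℂ) = {u^{⊕(r+1)} | u ∈ S(A)(h)(ℂ)}` (iff form of the tree's) and
  **`G(A^{r+1})(Σ prᵢ^* h)(ℂ) = {u^{⊕(r+1)} | u ∈ G(A)(h)(ℂ)}`** (`0 < dim A`, `h^{dim A} ≠ 0`): every element of
  `C(A^{r+1})` is diagonal, and its last block carries the multiplier of the polarization pairing; hence
  `S(A)(h) ≅ S(A^{r+1})(Σ prᵢ^* h)`, **`G(A)(h) ≅ G(A^{r+1})(Σ prᵢ^* h)`** as abstract groups;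
* §3 **Thm. 4.4 on `H¹` for `Σ prᵢ^* h` on `A^{r+1}`** (four properties inherited), so
  **`{g₁ | g ∈ ker l(A^{r+1})(ℂ)} = {u^{⊕(r+1)} | u ∈ {g₁ | g ∈ ker l(A)(ℂ)}}`** and
  **`L(A^{r+1})(ℂ)|_{H¹} = {u^{⊕(r+1)} | u ∈ L(A)(ℂ)|_{H¹}}`** — no class in these statements — with the abstract-group
  isomorphisms `{g₁ | g ∈ ker l(A)} ≅ {g₁ | g ∈ ker l(A^{r+1})}`, `L(A)|_{H¹} ≅ L(A^{r+1})|_{H¹}`;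
* §4 against the Mumford–Tate group of the power (`Milne1999/MumfordTateGroupPowersMulEquiv`: `MT(A^{r+1})|_{H¹}` is
  diagonal): **`MT(A^{r+1})|_{H¹} ⊓ S(A^{r+1})(Σ prᵢ^* h) = Hg(A^{r+1})|_{H¹}`** for `h` a polarization class of `A`, and the
  equivalences **`Hg(A^{r+1})|_{H¹} = S(A^{r+1}) ⟺ Hg(A)|_{H¹} = S(A)`**, **`MT(A^{r+1})|_{H¹} = G(A^{r+1}) ⟺ MT(A)|_{H¹} = G(A)`**,
  and class-free **`Hg(A^{r+1})|_{H¹} = {g₁ | g ∈ ker l(A^{r+1})} ⟺ Hg(A)|_{H¹} = {g₁ | g ∈ ker l(A)}`**,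
  **`MT(A^{r+1})|_{H¹} = L(A^{r+1})|_{H¹} ⟺ MT(A)|_{H¹} = L(A)|_{H¹}`** (and the strict `<` version) — «Mumford–Tate =
  Lefschetz» is insensitive to powers (Moonen–Zarhin: `Hg(Xⁿ)` is `Hg(X)` acting diagonally).

## References

* [Milne1999LefschetzClasses] J. S. Milne, *Lefschetz classes on abelian varieties*, Duke Math. J. 96 (1999), §1
  pp. 643–644, Prop. 1.5, §4 Thm. 4.4, Def. 4.6, Cor. 4.7.
* [LangeBirkenhake1992] H. Lange, Ch. Birkenhake, *Complex Abelian Varieties* (1992), §5.3 (product polarization).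
* [MoonenZarhin1999LowDim] B. Moonen, Yu. G. Zarhin, Math. Ann. 315 (1999), §1 (`Hg(Xⁿ)` acting diagonally).
-/

noncomputable section

open CategoryTheory
open Literature.AlgebraicTopology.SingularHomology
open Literature.AlgebraicGeometry.Motives
open Literature.AlgebraicGeometry.HodgeTheory
open Literature.AlgebraicGeometry.VanGeemen1994 (hodgeGroupOne mem_hodgeGroupOne_iff hodgeClassSpan)
open Literature.Geometry.Kaehler (lefschetzPow)

namespace Literature.AlgebraicGeometry.Milne1999

/-! ### §1 `Σ prᵢ^* h` is rational and of type `(1,1)` -/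

section Classes

variable {A B C : AbelianVariety ℂ} {h : complexBetti A.X 2} {hB : complexBetti B.X 2} {hC : complexBetti C.X 2}

/-- `pr_B^* h_B + pr_C^* h_C` is rational for `h_B`, `h_C` rational. [cite: Milne1999LefschetzClasses, §1 p. 643] [cite: LangeBirkenhake1992, §5.3] -/
theorem isRationalClass_prodPolarizationClass (hQB : IsRationalClass hB) (hQC : IsRationalClass hC) :
    IsRationalClass (prodPolarizationClass B C hB hC) := by
  rw [prodPolarizationClass_def]
  exact (isRationalClass_complexBetti_map _ hQB).add (isRationalClass_complexBetti_map _ hQC)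

/-- `pr_B^* h_B + pr_C^* h_C` is of type `(1,1)` for `h_B`, `h_C` of type `(1,1)`. [cite: Milne1999LefschetzClasses, §1 p. 643]
[cite: VoisinHodgeI2002, §7.1.1 and §7.3.2] -/
theorem isOfHodgeType_prodPolarizationClass (h11B : IsOfHodgeType B.dim B.X 2 1 1 hB)
    (h11C : IsOfHodgeType C.dim C.X 2 1 1 hC) :
    IsOfHodgeType (B.prod C).dim (B.prod C).X 2 1 1 (prodPolarizationClass B C hB hC) := by
  rw [prodPolarizationClass_def]
  exact (h11B.map_of_isSmoothProjective AbelianVariety.isSmoothProjective_holds AbelianVariety.isSmoothProjective_holds _).add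
    AbelianVariety.isSmoothProjective_holds
    (h11C.map_of_isSmoothProjective AbelianVariety.isSmoothProjective_holds AbelianVariety.isSmoothProjective_holds _)

/-- `Σᵢ prᵢ^* h` on `A^{a+1}` is rational for `h` rational. [cite: Milne1999LefschetzClasses, §1 p. 643] -/
theorem isRationalClass_powPolarizationClass (hQ : IsRationalClass h) :
    ∀ a : ℕ, IsRationalClass (powPolarizationClass A h a)
  | 0 => hQ
  | a + 1 => isRationalClass_prodPolarizationClass (isRationalClass_powPolarizationClass hQ a) hQ

/-- `Σᵢ prᵢ^* h` on `A^{a+1}` is of type `(1,1)` for `h` of type `(1,1)`. [cite: Milne1999LefschetzClasses, §1 p. 643] -/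
theorem isOfHodgeType_powPolarizationClass (h11 : IsOfHodgeType A.dim A.X 2 1 1 h) :
    ∀ a : ℕ, IsOfHodgeType (A.powSucc a).dim (A.powSucc a).X 2 1 1 (powPolarizationClass A h a)
  | 0 => h11
  | a + 1 => isOfHodgeType_prodPolarizationClass (isOfHodgeType_powPolarizationClass h11 a) h11

end Classes

/-! ### §2 `S(A^{r+1})` and `G(A^{r+1})` are `S(A)` and `G(A)` acting diagonally -/

section Diagonal

variable {A : AbelianVariety ℂ} {h : complexBetti A.X 2}

/-- **`S(A^{r+1})(Σ prᵢ^* h)(ℂ) = {u^{⊕(r+1)} | u ∈ S(A)(h)(ℂ)}`** (`0 < dim A`, `h^{dim A} ≠ 0`), as an iff: the tree's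
`exists_mem_unitaryCentralizerGroup_diagPow_eq` (`Milne1999/LefschetzInvolutionIsLefschetz` §3: an element of
`S(A^{r+1})` is diagonal, `U = u^{⊕(r+1)}`, and its last block preserves `Q_h`) with the converse
`diagPow_mem_unitaryCentralizerGroup`. [cite: Milne1999LefschetzClasses, §1 pp. 643–644, Prop. 1.5 and Cor. 4.7] [cite: LangeBirkenhake1992, §5.3] -/
theorem mem_unitaryCentralizerGroup_powSucc_iff (hA0 : 0 < A.dim) (htop : lefschetzPow h (A.dim - 1) 2 h ≠ 0) (r : ℕ)
    (U : complexBetti (A.powSucc r).X 1 ≃ₗ[ℂ] complexBetti (A.powSucc r).X 1) :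
    U ∈ unitaryCentralizerGroup (A.powSucc r) (powPolarizationClass A h r) ↔
      ∃ u ∈ unitaryCentralizerGroup A h, diagPow A u r = U :=
  ⟨exists_mem_unitaryCentralizerGroup_diagPow_eq hA0 htop r U, by
    rintro ⟨u, hu, rfl⟩
    exact diagPow_mem_unitaryCentralizerGroup hA0 hu r⟩

/-- **`G(A^{r+1})(Σ prᵢ^* h)(ℂ) = {u^{⊕(r+1)} | u ∈ G(A)(h)(ℂ)}`** (`0 < dim A`, `h^{dim A} ≠ 0`): the diagonal embedding is onto
Milne's `G` of the power, with the same multiplier (Cor. 4.7 / Def. 4.6 for the factors of `A^{r+1}`, all equal to `A`).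
[cite: Milne1999LefschetzClasses, §1 p. 643, Def. 4.6 and Cor. 4.7] -/
theorem mem_similitudeCentralizerGroup_powSucc_iff (hA0 : 0 < A.dim) (htop : lefschetzPow h (A.dim - 1) 2 h ≠ 0) :
    ∀ (r : ℕ) (U : complexBetti (A.powSucc r).X 1 ≃ₗ[ℂ] complexBetti (A.powSucc r).X 1),
      U ∈ similitudeCentralizerGroup (A.powSucc r) (powPolarizationClass A h r) ↔
        ∃ u ∈ similitudeCentralizerGroup A h, diagPow A u r = U
  | 0, U => ⟨fun hU ↦ ⟨U, hU, rfl⟩, fun ⟨u, hu, e⟩ ↦ e ▸ hu⟩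
  | r + 1, U => by
    constructor
    · intro hU
      obtain ⟨u, hu, huU⟩ := exists_eq_diagPow_of_mem_centralizerGroup (r + 1) U hU.1
      refine ⟨u, ?_, huU⟩
      have hmem : prodBlockDiagEquiv (diagPow A u r) u ∈ centralizerGroup ((A.powSucc r).prod A) :=
        diagPow_mem_centralizerGroup hu (r + 1)
      have hU' : ((⟨prodBlockDiagEquiv (diagPow A u r) u, hmem⟩ : centralizerGroup ((A.powSucc r).prod A)) :
            complexBetti ((A.powSucc r).prod A).X 1 ≃ₗ[ℂ] complexBetti ((A.powSucc r).prod A).X 1) ∈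
          similitudeCentralizerGroup ((A.powSucc r).prod A)
            (prodPolarizationClass (A.powSucc r) A (powPolarizationClass A h r) h) := by
        change diagPow A u (r + 1) ∈ similitudeCentralizerGroup (A.powSucc (r + 1)) (powPolarizationClass A h (r + 1))
        rw [huU]
        exact hU
      obtain ⟨c, -, hc⟩ := (mem_similitudeCentralizerGroup_prod_iff
        (lefschetzPow_powPolarizationClass_self_ne_zero hA0 htop r) htop ⟨_, hmem⟩).1 hU'
      rw [centralizerGroup.restrictSndHom_prodBlockDiagEquiv hmem] at hc
      exact ⟨hu, c, hc⟩
    · rintro ⟨u, hu, rfl⟩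
      exact diagPow_mem_similitudeCentralizerGroup hA0 hu (r + 1)

/-- **`S(A)(h)(ℂ) ≅ S(A^{r+1})(Σ prᵢ^* h)(ℂ)`** as abstract groups (`0 < dim A`, `h^{dim A} ≠ 0`) — the tree's bijective
`unitaryCentralizerGroup.diagPowHom` (`unitaryCentralizerGroup.diagPowHom_bijective`) as a `MulEquiv`.
[cite: Milne1999LefschetzClasses, §1 pp. 643–644 and Cor. 4.7] -/
theorem nonempty_unitaryCentralizerGroup_powSucc_mulEquiv (hA0 : 0 < A.dim) (htop : lefschetzPow h (A.dim - 1) 2 h ≠ 0)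
    (r : ℕ) :
    Nonempty (unitaryCentralizerGroup A h ≃* unitaryCentralizerGroup (A.powSucc r) (powPolarizationClass A h r)) :=
  ⟨MulEquiv.ofBijective _ (unitaryCentralizerGroup.diagPowHom_bijective hA0 htop r)⟩

/-- **`G(A)(h)(ℂ) ≅ G(A^{r+1})(Σ prᵢ^* h)(ℂ)`, `u ↦ u^{⊕(r+1)}`** as abstract groups (`0 < dim A`, `h^{dim A} ≠ 0`).
[cite: Milne1999LefschetzClasses, §1 p. 643, §4 p. 659 and Cor. 4.7] -/
theorem nonempty_similitudeCentralizerGroup_powSucc_mulEquiv (hA0 : 0 < A.dim)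
    (htop : lefschetzPow h (A.dim - 1) 2 h ≠ 0) (r : ℕ) :
    Nonempty (similitudeCentralizerGroup A h ≃* similitudeCentralizerGroup (A.powSucc r) (powPolarizationClass A h r)) := by
  let D : (complexBetti A.X 1 ≃ₗ[ℂ] complexBetti A.X 1) →*
      (complexBetti (A.powSucc r).X 1 ≃ₗ[ℂ] complexBetti (A.powSucc r).X 1) :=
    { toFun := fun u ↦ diagPow A u r
      map_one' := diagPow_one r
      map_mul' := fun u v ↦ diagPow_mul u v r }
  have hD : (similitudeCentralizerGroup A h).map D = similitudeCentralizerGroup (A.powSucc r) (powPolarizationClass A h r) := by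
    ext U
    rw [Subgroup.mem_map, mem_similitudeCentralizerGroup_powSucc_iff hA0 htop r U]
    rfl
  have hinj : Function.Injective (D.subgroupMap (similitudeCentralizerGroup A h)) := by
    rintro ⟨u, hu⟩ ⟨v, hv⟩ e
    exact Subtype.ext (diagPow_injective (A := A) r (congrArg Subtype.val e))
  exact ⟨(MulEquiv.ofBijective _ ⟨hinj, MonoidHom.subgroupMap_surjective _ _⟩).trans (MulEquiv.subgroupCongr hD)⟩

end Diagonal

/-! ### §3 Thm. 4.4 on `H¹` for `Σ prᵢ^* h`; `{g₁ | g ∈ ker l(A^{r+1})}` and `L(A^{r+1})|_{H¹}` are diagonal -/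

section LefschetzGroups

variable {A : AbelianVariety ℂ} {h : complexBetti A.X 2}

variable (A) in
/-- **Thm. 4.4 on `H¹` for the product polarization `Σ prᵢ^* h` of `A^{r+1}`** from the four properties of `h` (rational,
type `(1,1)`, `h^{dim A} ≠ 0`, `Q_h` non-degenerate; `0 < dim A`): `{g₁ | g ∈ ker l(A^{r+1})(ℂ)} = S(A^{r+1})(Σ prᵢ^* h)(ℂ)`.
[cite: Milne1999LefschetzClasses, Thm. 4.4, §1 p. 643 and §4 p. 659] [cite: LangeBirkenhake1992, §5.3] -/
theorem specialLefschetzGroup_map_one_powSucc_eq_unitaryCentralizerGroup (hA0 : 0 < A.dim) (hQ : IsRationalClass h)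
    (h11 : IsOfHodgeType A.dim A.X 2 1 1 h) (htop : lefschetzPow h (A.dim - 1) 2 h ≠ 0)
    (hnd : ∀ x : complexBetti A.X 1, (∀ y, polarizationPairingOne A.X h (A.dim - 1) x y = 0) → x = 0) (r : ℕ) :
    (specialLefschetzGroup (A.powSucc r).dim (A.powSucc r).X).map
        (Pi.evalMonoidHom (fun k : ℕ ↦ complexBetti (A.powSucc r).X k ≃ₗ[ℂ] complexBetti (A.powSucc r).X k) 1) =
      unitaryCentralizerGroup (A.powSucc r) (powPolarizationClass A h r) :=
  specialLefschetzGroup_map_one_eq_unitaryCentralizerGroup_of_nondegenerate (A.powSucc r) (dim_powSucc_pos hA0 r)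
    (isRationalClass_powPolarizationClass hQ r) (isOfHodgeType_powPolarizationClass h11 r)
    (lefschetzPow_powPolarizationClass_self_ne_zero hA0 htop r)
    (eq_zero_of_forall_polarizationPairingOne_powPolarizationClass_eq_zero hA0 htop hnd r)

/-- **Thm. 4.4 on `H¹` for `Σ prᵢ^* h` of `A^{r+1}`, `h` an `IsPolarizationClass` of `A`** (`dim A ≥ 1`).
[cite: Milne1999LefschetzClasses, Thm. 4.4 and §1 p. 643] [cite: Andre1996Motifs, §1.1 (p. 10)] -/
theorem _root_.Literature.AlgebraicGeometry.HodgeTheory.IsPolarizationClass.specialLefschetzGroup_map_one_powSucc_eq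
    (hpol : IsPolarizationClass A.dim A.X h) (hA : 1 ≤ A.dim) (r : ℕ) :
    (specialLefschetzGroup (A.powSucc r).dim (A.powSucc r).X).map
        (Pi.evalMonoidHom (fun k : ℕ ↦ complexBetti (A.powSucc r).X k ≃ₗ[ℂ] complexBetti (A.powSucc r).X k) 1) =
      unitaryCentralizerGroup (A.powSucc r) (powPolarizationClass A h r) :=
  specialLefschetzGroup_map_one_powSucc_eq_unitaryCentralizerGroup A hA hpol.isRationalClass
    (isOfHodgeType_of_mem_algebraicClasses_of_isSmoothProjective AbelianVariety.isSmoothProjective_holds 1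
      hpol.mem_algebraicClasses)
    (AbelianVariety.lefschetzPow_self_ne_zero_of_hasHardLefschetzProperty hA hpol.hasHardLefschetz)
    (fun _ hx ↦ eq_zero_of_forall_polarizationPairingOne_eq_zero_of_hasHardLefschetzProperty hA hpol.hasHardLefschetz hx) r

/-- **`L(A^{r+1})(ℂ)|_{H¹} = G(A^{r+1})(Σ prᵢ^* h)(ℂ)` for `h` an `IsPolarizationClass` of `A`** (`dim A ≥ 1`).
[cite: Milne1999LefschetzClasses, Thm. 4.4, §4 p. 659 and Cor. 4.7] -/
theorem _root_.Literature.AlgebraicGeometry.HodgeTheory.IsPolarizationClass.lefschetzGroup_map_one_powSucc_eq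
    (hpol : IsPolarizationClass A.dim A.X h) (hA : 1 ≤ A.dim) (r : ℕ) :
    (lefschetzGroup (A.powSucc r).dim (A.powSucc r).X).map
        (Pi.evalMonoidHom (fun k : ℕ ↦ complexBetti (A.powSucc r).X k ≃ₗ[ℂ] complexBetti (A.powSucc r).X k) 1) =
      similitudeCentralizerGroup (A.powSucc r) (powPolarizationClass A h r) :=
  lefschetzGroup_map_one_eq_similitudeCentralizerGroup_of_eq (powPolarizationClass_mem_hodgeClassSpan hpol.mem_hodgeClassSpan_one r)
    (hpol.specialLefschetzGroup_map_one_powSucc_eq hA r)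

variable (A) in
/-- **`{g₁ | g ∈ ker l(A^{r+1})(ℂ)} = {u^{⊕(r+1)} | u ∈ {g₁ | g ∈ ker l(A)(ℂ)}}`** for every complex abelian variety of positive
dimension — no class in the statement (a polarization class of `A` exists and its product class polarizes `A^{r+1}`).
[cite: Milne1999LefschetzClasses, §1 pp. 643–644, Thm. 4.4 and Cor. 4.7] -/
theorem mem_map_specialLefschetzGroup_one_powSucc_iff (hA : 1 ≤ A.dim) (r : ℕ)
    (U : complexBetti (A.powSucc r).X 1 ≃ₗ[ℂ] complexBetti (A.powSucc r).X 1) :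
    U ∈ (specialLefschetzGroup (A.powSucc r).dim (A.powSucc r).X).map
        (Pi.evalMonoidHom (fun k : ℕ ↦ complexBetti (A.powSucc r).X k ≃ₗ[ℂ] complexBetti (A.powSucc r).X k) 1) ↔
      ∃ u ∈ (specialLefschetzGroup A.dim A.X).map
          (Pi.evalMonoidHom (fun k : ℕ ↦ complexBetti A.X k ≃ₗ[ℂ] complexBetti A.X k) 1), diagPow A u r = U := by
  obtain ⟨h, hpol⟩ := exists_isPolarizationClass (AbelianVariety.isSmoothProjective_holds (A := A))
  rw [hpol.specialLefschetzGroup_map_one_powSucc_eq hA r, hpol.specialLefschetzGroup_map_one_eq hA]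
  exact mem_unitaryCentralizerGroup_powSucc_iff hA
    (AbelianVariety.lefschetzPow_self_ne_zero_of_hasHardLefschetzProperty hA hpol.hasHardLefschetz) r U

variable (A) in
/-- **`L(A^{r+1})(ℂ)|_{H¹} = {u^{⊕(r+1)} | u ∈ L(A)(ℂ)|_{H¹}}`** for every complex abelian variety of positive dimension — no
class in the statement. [cite: Milne1999LefschetzClasses, §1 p. 643, §4 pp. 658–659 and Cor. 4.7] -/
theorem mem_map_lefschetzGroup_one_powSucc_iff (hA : 1 ≤ A.dim) (r : ℕ)
    (U : complexBetti (A.powSucc r).X 1 ≃ₗ[ℂ] complexBetti (A.powSucc r).X 1) :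
    U ∈ (lefschetzGroup (A.powSucc r).dim (A.powSucc r).X).map
        (Pi.evalMonoidHom (fun k : ℕ ↦ complexBetti (A.powSucc r).X k ≃ₗ[ℂ] complexBetti (A.powSucc r).X k) 1) ↔
      ∃ u ∈ (lefschetzGroup A.dim A.X).map
          (Pi.evalMonoidHom (fun k : ℕ ↦ complexBetti A.X k ≃ₗ[ℂ] complexBetti A.X k) 1), diagPow A u r = U := by
  obtain ⟨h, hpol⟩ := exists_isPolarizationClass (AbelianVariety.isSmoothProjective_holds (A := A))
  rw [hpol.lefschetzGroup_map_one_powSucc_eq hA r, hpol.lefschetzGroup_map_one_eq hA]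
  exact mem_similitudeCentralizerGroup_powSucc_iff hA
    (AbelianVariety.lefschetzPow_self_ne_zero_of_hasHardLefschetzProperty hA hpol.hasHardLefschetz) r U

/-- `u^{⊕(r+1)} ∈ {g₁ | g ∈ ker l(A^{r+1})(ℂ)} ⟺ u ∈ {g₁ | g ∈ ker l(A)(ℂ)}` (`dim A ≥ 1`). [cite: Milne1999LefschetzClasses, §1 pp. 643–644 and Thm. 4.4] -/
theorem diagPow_mem_map_specialLefschetzGroup_one_powSucc_iff (hA : 1 ≤ A.dim) (r : ℕ)
    (u : complexBetti A.X 1 ≃ₗ[ℂ] complexBetti A.X 1) :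
    diagPow A u r ∈ (specialLefschetzGroup (A.powSucc r).dim (A.powSucc r).X).map
        (Pi.evalMonoidHom (fun k : ℕ ↦ complexBetti (A.powSucc r).X k ≃ₗ[ℂ] complexBetti (A.powSucc r).X k) 1) ↔
      u ∈ (specialLefschetzGroup A.dim A.X).map
        (Pi.evalMonoidHom (fun k : ℕ ↦ complexBetti A.X k ≃ₗ[ℂ] complexBetti A.X k) 1) := by
  rw [mem_map_specialLefschetzGroup_one_powSucc_iff A hA r]
  constructor
  · rintro ⟨v, hv, e⟩
    rwa [← diagPow_injective (A := A) r e]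
  · exact fun hu ↦ ⟨u, hu, rfl⟩

/-- `u^{⊕(r+1)} ∈ L(A^{r+1})(ℂ)|_{H¹} ⟺ u ∈ L(A)(ℂ)|_{H¹}` (`dim A ≥ 1`). [cite: Milne1999LefschetzClasses, §1 p. 643 and §4 pp. 658–659] -/
theorem diagPow_mem_map_lefschetzGroup_one_powSucc_iff (hA : 1 ≤ A.dim) (r : ℕ)
    (u : complexBetti A.X 1 ≃ₗ[ℂ] complexBetti A.X 1) :
    diagPow A u r ∈ (lefschetzGroup (A.powSucc r).dim (A.powSucc r).X).map
        (Pi.evalMonoidHom (fun k : ℕ ↦ complexBetti (A.powSucc r).X k ≃ₗ[ℂ] complexBetti (A.powSucc r).X k) 1) ↔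
      u ∈ (lefschetzGroup A.dim A.X).map
        (Pi.evalMonoidHom (fun k : ℕ ↦ complexBetti A.X k ≃ₗ[ℂ] complexBetti A.X k) 1) := by
  rw [mem_map_lefschetzGroup_one_powSucc_iff A hA r]
  constructor
  · rintro ⟨v, hv, e⟩
    rwa [← diagPow_injective (A := A) r e]
  · exact fun hu ↦ ⟨u, hu, rfl⟩

variable (A) in
/-- **`{g₁ | g ∈ ker l(A)(ℂ)} ≅ {g₁ | g ∈ ker l(A^{r+1})(ℂ)}`, `u ↦ u^{⊕(r+1)}`** as abstract groups (`dim A ≥ 1`).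
[cite: Milne1999LefschetzClasses, §1 pp. 643–644, Thm. 4.4 and Cor. 4.7] -/
theorem nonempty_map_specialLefschetzGroup_one_powSucc_mulEquiv (hA : 1 ≤ A.dim) (r : ℕ) :
    Nonempty ((specialLefschetzGroup A.dim A.X).map
        (Pi.evalMonoidHom (fun k : ℕ ↦ complexBetti A.X k ≃ₗ[ℂ] complexBetti A.X k) 1) ≃*
      (specialLefschetzGroup (A.powSucc r).dim (A.powSucc r).X).map
        (Pi.evalMonoidHom (fun k : ℕ ↦ complexBetti (A.powSucc r).X k ≃ₗ[ℂ] complexBetti (A.powSucc r).X k) 1)) := by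
  let D : (complexBetti A.X 1 ≃ₗ[ℂ] complexBetti A.X 1) →*
      (complexBetti (A.powSucc r).X 1 ≃ₗ[ℂ] complexBetti (A.powSucc r).X 1) :=
    { toFun := fun u ↦ diagPow A u r
      map_one' := diagPow_one r
      map_mul' := fun u v ↦ diagPow_mul u v r }
  have hD : ((specialLefschetzGroup A.dim A.X).map
      (Pi.evalMonoidHom (fun k : ℕ ↦ complexBetti A.X k ≃ₗ[ℂ] complexBetti A.X k) 1)).map D =
      (specialLefschetzGroup (A.powSucc r).dim (A.powSucc r).X).map
        (Pi.evalMonoidHom (fun k : ℕ ↦ complexBetti (A.powSucc r).X k ≃ₗ[ℂ] complexBetti (A.powSucc r).X k) 1) := by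
    ext U
    rw [Subgroup.mem_map, mem_map_specialLefschetzGroup_one_powSucc_iff A hA r U]
    rfl
  have hinj : Function.Injective (D.subgroupMap ((specialLefschetzGroup A.dim A.X).map
      (Pi.evalMonoidHom (fun k : ℕ ↦ complexBetti A.X k ≃ₗ[ℂ] complexBetti A.X k) 1))) := by
    rintro ⟨u, hu⟩ ⟨v, hv⟩ e
    exact Subtype.ext (diagPow_injective (A := A) r (congrArg Subtype.val e))
  exact ⟨(MulEquiv.ofBijective _ ⟨hinj, MonoidHom.subgroupMap_surjective _ _⟩).trans (MulEquiv.subgroupCongr hD)⟩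

variable (A) in
/-- **`L(A)(ℂ)|_{H¹} ≅ L(A^{r+1})(ℂ)|_{H¹}`, `u ↦ u^{⊕(r+1)}`** as abstract groups (`dim A ≥ 1`) — Milne's Lefschetz group of
a power, on `H¹`, is the Lefschetz group acting diagonally. [cite: Milne1999LefschetzClasses, §1 p. 643, §4 pp. 658–659 and Cor. 4.7] -/
theorem nonempty_map_lefschetzGroup_one_powSucc_mulEquiv (hA : 1 ≤ A.dim) (r : ℕ) :
    Nonempty ((lefschetzGroup A.dim A.X).map
        (Pi.evalMonoidHom (fun k : ℕ ↦ complexBetti A.X k ≃ₗ[ℂ] complexBetti A.X k) 1) ≃*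
      (lefschetzGroup (A.powSucc r).dim (A.powSucc r).X).map
        (Pi.evalMonoidHom (fun k : ℕ ↦ complexBetti (A.powSucc r).X k ≃ₗ[ℂ] complexBetti (A.powSucc r).X k) 1)) := by
  let D : (complexBetti A.X 1 ≃ₗ[ℂ] complexBetti A.X 1) →*
      (complexBetti (A.powSucc r).X 1 ≃ₗ[ℂ] complexBetti (A.powSucc r).X 1) :=
    { toFun := fun u ↦ diagPow A u r
      map_one' := diagPow_one r
      map_mul' := fun u v ↦ diagPow_mul u v r }
  have hD : ((lefschetzGroup A.dim A.X).map
      (Pi.evalMonoidHom (fun k : ℕ ↦ complexBetti A.X k ≃ₗ[ℂ] complexBetti A.X k) 1)).map D =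
      (lefschetzGroup (A.powSucc r).dim (A.powSucc r).X).map
        (Pi.evalMonoidHom (fun k : ℕ ↦ complexBetti (A.powSucc r).X k ≃ₗ[ℂ] complexBetti (A.powSucc r).X k) 1) := by
    ext U
    rw [Subgroup.mem_map, mem_map_lefschetzGroup_one_powSucc_iff A hA r U]
    rfl
  have hinj : Function.Injective (D.subgroupMap ((lefschetzGroup A.dim A.X).map
      (Pi.evalMonoidHom (fun k : ℕ ↦ complexBetti A.X k ≃ₗ[ℂ] complexBetti A.X k) 1))) := by
    rintro ⟨u, hu⟩ ⟨v, hv⟩ e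
    exact Subtype.ext (diagPow_injective (A := A) r (congrArg Subtype.val e))
  exact ⟨(MulEquiv.ofBijective _ ⟨hinj, MonoidHom.subgroupMap_surjective _ _⟩).trans (MulEquiv.subgroupCongr hD)⟩

end LefschetzGroups

/-! ### §4 `MT(A^{r+1})` against `S`, `ker l`, `L` of the power: `Hg = MT ∩ S` and «Mumford–Tate = Lefschetz» pass to powers -/

section MumfordTate

variable {A : AbelianVariety ℂ} {h : complexBetti A.X 2}

/-- **`MT(A^{r+1})(ℂ)|_{H¹} ⊓ S(A^{r+1})(Σ prᵢ^* h)(ℂ) = Hg(A^{r+1})(ℂ)|_{H¹}`** for `h` a polarization class of `A`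
(`dim A ≥ 1`): `Hg(A^{r+1})|_{H¹}` fixes the Hodge class `Σ prᵢ^* h`, and a scalar `c · 1 = (c · 1)^{⊕(r+1)}` lies in
`S(A^{r+1})` iff `c · 1 ∈ S(A)(h)` iff `c² = 1`. [cite: Milne1999LefschetzClasses, §1 p. 643 and §4 pp. 659–660 (L(A) ⊃ Hg(A))]
[cite: MoonenZarhin1999LowDim, §1] -/
theorem _root_.Literature.AlgebraicGeometry.HodgeTheory.IsPolarizationClass.map_mumfordTateGroup_powSucc_inf_unitaryCentralizerGroup_eq
    (hpol : IsPolarizationClass A.dim A.X h) (hA : 1 ≤ A.dim) (r : ℕ) :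
    (mumfordTateGroup (A.powSucc r).dim (A.powSucc r).X).map
        (Pi.evalMonoidHom (fun k : ℕ ↦ complexBetti (A.powSucc r).X k ≃ₗ[ℂ] complexBetti (A.powSucc r).X k) 1) ⊓
        unitaryCentralizerGroup (A.powSucc r) (powPolarizationClass A h r) =
      hodgeGroupOne (A.powSucc r).dim (A.powSucc r).X := by
  refine map_mumfordTateGroup_inf_eq_hodgeGroupOne_of_le (dim_powSucc_pos hA r)
    (hodgeGroupOne_le_unitaryCentralizerGroup (powPolarizationClass_mem_hodgeClassSpan hpol.mem_hodgeClassSpan_one r)) ?_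
  intro c hc
  rw [← diagPow_smulOfUnit A c r,
    mem_unitaryCentralizerGroup_powSucc_iff hA
      (AbelianVariety.lefschetzPow_self_ne_zero_of_hasHardLefschetzProperty hA hpol.hasHardLefschetz) r] at hc
  obtain ⟨u, hu, e⟩ := hc
  rw [diagPow_injective (A := A) r e] at hu
  exact (Deligne1982.smulOfUnit_mem_unitaryCentralizerGroup_iff hpol hA).1 hu

/-- `u ∈ Hg(A^{r+1})(ℂ)|_{H¹}` iff `u ∈ MT(A^{r+1})(ℂ)|_{H¹}` and `u ∈ S(A^{r+1})(Σ prᵢ^* h)(ℂ)` (`h` a polarization class of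
`A`, `dim A ≥ 1`). [cite: Milne1999LefschetzClasses, §1 p. 643 and §4 pp. 659–660] -/
theorem _root_.Literature.AlgebraicGeometry.HodgeTheory.IsPolarizationClass.mem_hodgeGroupOne_powSucc_iff
    (hpol : IsPolarizationClass A.dim A.X h) (hA : 1 ≤ A.dim) (r : ℕ)
    (U : complexBetti (A.powSucc r).X 1 ≃ₗ[ℂ] complexBetti (A.powSucc r).X 1) :
    U ∈ hodgeGroupOne (A.powSucc r).dim (A.powSucc r).X ↔
      U ∈ (mumfordTateGroup (A.powSucc r).dim (A.powSucc r).X).map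
          (Pi.evalMonoidHom (fun k : ℕ ↦ complexBetti (A.powSucc r).X k ≃ₗ[ℂ] complexBetti (A.powSucc r).X k) 1) ∧
        U ∈ unitaryCentralizerGroup (A.powSucc r) (powPolarizationClass A h r) := by
  rw [← hpol.map_mumfordTateGroup_powSucc_inf_unitaryCentralizerGroup_eq hA r, Subgroup.mem_inf]

/-- **`S(A^{r+1})(Σ prᵢ^* h)(ℂ) ≤ MT(A^{r+1})(ℂ)|_{H¹} ⟺ S(A)(h)(ℂ) ≤ MT(A)(ℂ)|_{H¹}`** (`h` with `h^{dim A} ≠ 0`,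
`0 < dim A`): both sides are the diagonal images. [cite: Milne1999LefschetzClasses, §1 p. 643 and §4 p. 660] [cite: MoonenZarhin1999LowDim, §1] -/
theorem unitaryCentralizerGroup_powSucc_le_map_mumfordTateGroup_one_iff (hA0 : 0 < A.dim)
    (htop : lefschetzPow h (A.dim - 1) 2 h ≠ 0) (r : ℕ) :
    unitaryCentralizerGroup (A.powSucc r) (powPolarizationClass A h r) ≤
        (mumfordTateGroup (A.powSucc r).dim (A.powSucc r).X).map
          (Pi.evalMonoidHom (fun k : ℕ ↦ complexBetti (A.powSucc r).X k ≃ₗ[ℂ] complexBetti (A.powSucc r).X k) 1) ↔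
      unitaryCentralizerGroup A h ≤ (mumfordTateGroup A.dim A.X).map
        (Pi.evalMonoidHom (fun k : ℕ ↦ complexBetti A.X k ≃ₗ[ℂ] complexBetti A.X k) 1) := by
  constructor
  · intro hle u hu
    exact (diagPow_mem_map_mumfordTateGroup_one_powSucc_iff A r u).1
      (hle (diagPow_mem_unitaryCentralizerGroup hA0 hu r))
  · intro hle U hU
    obtain ⟨u, hu, rfl⟩ := (mem_unitaryCentralizerGroup_powSucc_iff hA0 htop r U).1 hU
    exact (diagPow_mem_map_mumfordTateGroup_one_powSucc_iff A r u).2 (hle hu)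

/-- **`Hg(A^{r+1})(ℂ)|_{H¹} = S(A^{r+1})(Σ prᵢ^* h)(ℂ) ⟺ Hg(A)(ℂ)|_{H¹} = S(A)(h)(ℂ)`** for `h` a polarization class of `A`
(`dim A ≥ 1`): «the Hodge group is the full Lefschetz-type group `S`» passes to and from powers.
[cite: Milne1999LefschetzClasses, §1 p. 643, §4 p. 660 and Cor. 4.7] [cite: MoonenZarhin1999LowDim, §1] -/
theorem _root_.Literature.AlgebraicGeometry.HodgeTheory.IsPolarizationClass.hodgeGroupOne_powSucc_eq_unitaryCentralizerGroup_iff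
    (hpol : IsPolarizationClass A.dim A.X h) (hA : 1 ≤ A.dim) (r : ℕ) :
    hodgeGroupOne (A.powSucc r).dim (A.powSucc r).X = unitaryCentralizerGroup (A.powSucc r) (powPolarizationClass A h r) ↔
      hodgeGroupOne A.dim A.X = unitaryCentralizerGroup A h := by
  rw [← unitaryCentralizerGroup_le_map_mumfordTateGroup_iff hpol hA,
    ← unitaryCentralizerGroup_powSucc_le_map_mumfordTateGroup_one_iff hA
      (AbelianVariety.lefschetzPow_self_ne_zero_of_hasHardLefschetzProperty hA hpol.hasHardLefschetz) r,
    ← hpol.map_mumfordTateGroup_powSucc_inf_unitaryCentralizerGroup_eq hA r]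
  exact ⟨fun e ↦ e ▸ inf_le_left, fun hle ↦ inf_eq_right.2 hle⟩

/-- **`MT(A^{r+1})(ℂ)|_{H¹} = G(A^{r+1})(Σ prᵢ^* h)(ℂ) ⟺ MT(A)(ℂ)|_{H¹} = G(A)(h)(ℂ)`** for `h` a polarization class of `A`
(`dim A ≥ 1`). [cite: Milne1999LefschetzClasses, §1 p. 643, §4 pp. 659–660 and Cor. 4.7] [cite: MoonenZarhin1999LowDim, §1] -/
theorem _root_.Literature.AlgebraicGeometry.HodgeTheory.IsPolarizationClass.map_mumfordTateGroup_powSucc_eq_similitudeCentralizerGroup_iff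
    (hpol : IsPolarizationClass A.dim A.X h) (hA : 1 ≤ A.dim) (r : ℕ) :
    (mumfordTateGroup (A.powSucc r).dim (A.powSucc r).X).map
        (Pi.evalMonoidHom (fun k : ℕ ↦ complexBetti (A.powSucc r).X k ≃ₗ[ℂ] complexBetti (A.powSucc r).X k) 1) =
        similitudeCentralizerGroup (A.powSucc r) (powPolarizationClass A h r) ↔
      (mumfordTateGroup A.dim A.X).map
        (Pi.evalMonoidHom (fun k : ℕ ↦ complexBetti A.X k ≃ₗ[ℂ] complexBetti A.X k) 1) =
        similitudeCentralizerGroup A h := by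
  rw [map_mumfordTateGroup_eq_similitudeCentralizerGroup_iff hpol hA,
    ← hpol.hodgeGroupOne_powSucc_eq_unitaryCentralizerGroup_iff hA r,
    ← map_mumfordTateGroup_sup_unitaryCentralizerGroup_eq_similitudeCentralizerGroup
      (powPolarizationClass_mem_hodgeClassSpan hpol.mem_hodgeClassSpan_one r),
    ← hpol.map_mumfordTateGroup_powSucc_inf_unitaryCentralizerGroup_eq hA r, eq_comm, sup_eq_left]
  exact ⟨fun hle ↦ inf_eq_right.2 hle, fun e ↦ e ▸ inf_le_left⟩

variable (A) in
/-- **`{g₁ | g ∈ ker l(A^{r+1})(ℂ)} ≤ MT(A^{r+1})(ℂ)|_{H¹} ⟺ {g₁ | g ∈ ker l(A)(ℂ)} ≤ MT(A)(ℂ)|_{H¹}`** for every complex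
abelian variety of positive dimension — no class in the statement. [cite: Milne1999LefschetzClasses, §1 p. 643, Thm. 4.4 and §4 p. 660]
[cite: MoonenZarhin1999LowDim, §1] -/
theorem map_specialLefschetzGroup_one_powSucc_le_map_mumfordTateGroup_one_iff (hA : 1 ≤ A.dim) (r : ℕ) :
    (specialLefschetzGroup (A.powSucc r).dim (A.powSucc r).X).map
        (Pi.evalMonoidHom (fun k : ℕ ↦ complexBetti (A.powSucc r).X k ≃ₗ[ℂ] complexBetti (A.powSucc r).X k) 1) ≤
        (mumfordTateGroup (A.powSucc r).dim (A.powSucc r).X).map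
          (Pi.evalMonoidHom (fun k : ℕ ↦ complexBetti (A.powSucc r).X k ≃ₗ[ℂ] complexBetti (A.powSucc r).X k) 1) ↔
      (specialLefschetzGroup A.dim A.X).map
          (Pi.evalMonoidHom (fun k : ℕ ↦ complexBetti A.X k ≃ₗ[ℂ] complexBetti A.X k) 1) ≤
        (mumfordTateGroup A.dim A.X).map
          (Pi.evalMonoidHom (fun k : ℕ ↦ complexBetti A.X k ≃ₗ[ℂ] complexBetti A.X k) 1) := by
  constructor
  · intro hle u hu
    exact (diagPow_mem_map_mumfordTateGroup_one_powSucc_iff A r u).1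
      (hle ((diagPow_mem_map_specialLefschetzGroup_one_powSucc_iff hA r u).2 hu))
  · intro hle U hU
    obtain ⟨u, hu, rfl⟩ := (mem_map_specialLefschetzGroup_one_powSucc_iff A hA r U).1 hU
    exact (diagPow_mem_map_mumfordTateGroup_one_powSucc_iff A r u).2 (hle hu)

variable (A) in
/-- **`Hg(A^{r+1})(ℂ)|_{H¹} = {g₁ | g ∈ ker l(A^{r+1})(ℂ)} ⟺ Hg(A)(ℂ)|_{H¹} = {g₁ | g ∈ ker l(A)(ℂ)}`** (`dim A ≥ 1`) — no class in
the statement. [cite: Milne1999LefschetzClasses, §1 p. 643, Thm. 4.4, §4 p. 660 and Cor. 4.7] [cite: MoonenZarhin1999LowDim, §1] -/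
theorem hodgeGroupOne_powSucc_eq_map_specialLefschetzGroup_one_iff (hA : 1 ≤ A.dim) (r : ℕ) :
    hodgeGroupOne (A.powSucc r).dim (A.powSucc r).X = (specialLefschetzGroup (A.powSucc r).dim (A.powSucc r).X).map
        (Pi.evalMonoidHom (fun k : ℕ ↦ complexBetti (A.powSucc r).X k ≃ₗ[ℂ] complexBetti (A.powSucc r).X k) 1) ↔
      hodgeGroupOne A.dim A.X = (specialLefschetzGroup A.dim A.X).map
        (Pi.evalMonoidHom (fun k : ℕ ↦ complexBetti A.X k ≃ₗ[ℂ] complexBetti A.X k) 1) := by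
  rw [← map_specialLefschetzGroup_le_map_mumfordTateGroup_iff hA,
    ← map_specialLefschetzGroup_le_map_mumfordTateGroup_iff (dim_powSucc_pos hA r)]
  exact map_specialLefschetzGroup_one_powSucc_le_map_mumfordTateGroup_one_iff A hA r

variable (A) in
/-- **`MT(A^{r+1})(ℂ)|_{H¹} = L(A^{r+1})(ℂ)|_{H¹} ⟺ MT(A)(ℂ)|_{H¹} = L(A)(ℂ)|_{H¹}`** (`dim A ≥ 1`) — «Mumford–Tate = Lefschetz
on `H¹`» passes to and from powers; no class in the statement. [cite: Milne1999LefschetzClasses, §1 p. 643, §4 pp. 659–660 and Cor. 4.7]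
[cite: MoonenZarhin1999LowDim, §1] -/
theorem map_mumfordTateGroup_one_powSucc_eq_map_lefschetzGroup_one_iff (hA : 1 ≤ A.dim) (r : ℕ) :
    (mumfordTateGroup (A.powSucc r).dim (A.powSucc r).X).map
        (Pi.evalMonoidHom (fun k : ℕ ↦ complexBetti (A.powSucc r).X k ≃ₗ[ℂ] complexBetti (A.powSucc r).X k) 1) =
        (lefschetzGroup (A.powSucc r).dim (A.powSucc r).X).map
          (Pi.evalMonoidHom (fun k : ℕ ↦ complexBetti (A.powSucc r).X k ≃ₗ[ℂ] complexBetti (A.powSucc r).X k) 1) ↔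
      (mumfordTateGroup A.dim A.X).map
          (Pi.evalMonoidHom (fun k : ℕ ↦ complexBetti A.X k ≃ₗ[ℂ] complexBetti A.X k) 1) =
        (lefschetzGroup A.dim A.X).map
          (Pi.evalMonoidHom (fun k : ℕ ↦ complexBetti A.X k ≃ₗ[ℂ] complexBetti A.X k) 1) := by
  rw [← map_mumfordTateGroup_sup_map_specialLefschetzGroup_eq_map_lefschetzGroup (A := A.powSucc r),
    ← map_mumfordTateGroup_sup_map_specialLefschetzGroup_eq_map_lefschetzGroup (A := A)]
  constructor
  · intro e
    exact (sup_eq_left.2 ((map_specialLefschetzGroup_one_powSucc_le_map_mumfordTateGroup_one_iff A hA r).1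
      (sup_eq_left.1 e.symm))).symm
  · intro e
    exact (sup_eq_left.2 ((map_specialLefschetzGroup_one_powSucc_le_map_mumfordTateGroup_one_iff A hA r).2
      (sup_eq_left.1 e.symm))).symm

variable (A) in
/-- **`MT(A^{r+1})(ℂ)|_{H¹} < L(A^{r+1})(ℂ)|_{H¹} ⟺ MT(A)(ℂ)|_{H¹} < L(A)(ℂ)|_{H¹}`** (`dim A ≥ 1`): a proper Mumford–Tate group
inside the Lefschetz group on `H¹` is seen on every power and conversely. [cite: Milne1999LefschetzClasses, §1 p. 643 and §4 pp. 659–660]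
[cite: MoonenZarhin1999LowDim, §1] -/
theorem map_mumfordTateGroup_one_powSucc_lt_map_lefschetzGroup_one_iff (hA : 1 ≤ A.dim) (r : ℕ) :
    (mumfordTateGroup (A.powSucc r).dim (A.powSucc r).X).map
        (Pi.evalMonoidHom (fun k : ℕ ↦ complexBetti (A.powSucc r).X k ≃ₗ[ℂ] complexBetti (A.powSucc r).X k) 1) <
        (lefschetzGroup (A.powSucc r).dim (A.powSucc r).X).map
          (Pi.evalMonoidHom (fun k : ℕ ↦ complexBetti (A.powSucc r).X k ≃ₗ[ℂ] complexBetti (A.powSucc r).X k) 1) ↔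
      (mumfordTateGroup A.dim A.X).map
          (Pi.evalMonoidHom (fun k : ℕ ↦ complexBetti A.X k ≃ₗ[ℂ] complexBetti A.X k) 1) <
        (lefschetzGroup A.dim A.X).map
          (Pi.evalMonoidHom (fun k : ℕ ↦ complexBetti A.X k ≃ₗ[ℂ] complexBetti A.X k) 1) := by
  have hle : ∀ B : AbelianVariety ℂ, (mumfordTateGroup B.dim B.X).map
      (Pi.evalMonoidHom (fun k : ℕ ↦ complexBetti B.X k ≃ₗ[ℂ] complexBetti B.X k) 1) ≤
      (lefschetzGroup B.dim B.X).map (Pi.evalMonoidHom (fun k : ℕ ↦ complexBetti B.X k ≃ₗ[ℂ] complexBetti B.X k) 1) :=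
    fun B ↦ by
      rw [← map_mumfordTateGroup_sup_map_specialLefschetzGroup_eq_map_lefschetzGroup (A := B)]
      exact le_sup_left
  rw [lt_iff_le_and_ne, lt_iff_le_and_ne, and_iff_right (hle _), and_iff_right (hle _), Ne, Ne,
    map_mumfordTateGroup_one_powSucc_eq_map_lefschetzGroup_one_iff A hA r]

end MumfordTate

end Literature.AlgebraicGeometry.Milne1999

end
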